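import Summits.NavierStokesRegularity.NavierStokesRegularity.Theorems.TypeIIInviscidRelaxationAxisymSwirlRegularRadialMomentumCalculus
import Literature.Analysis.FluidPDE.AxisymmetricL3OffTube
import Literature.Analysis.FluidPDE.ParabolicWeakMaxPointwise
import Literature.Analysis.FluidPDE.SpaceTimeCalculus
import Mathlib.Topology.Order.Compact
import HarnessLib

/-!
# Crux `AxisymSwirlRegular` (stmt-NavierStokesRegularity-1964), line `radial_inflow_split`, piece X₂
# `AprioriRadialInflowBound`: the radial-momentum minimum principle — X₂ follows from S1 alone

`--supports stmt-NavierStokesRegularity-1964` (helper file; theorems only, no definitions).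

The birth skeleton `Cruxes/AxisymSwirlRegular/Lines/AprioriRadialInflowBound_birth.lean` reduces the
route item `AprioriRadialInflowBound` (⟨19060⟩, piece X₂ of the registered line `radial_inflow_split`
of the crux ⟨1964⟩; the a-priori one-sided inflow bound `x₀u₀ + x₁u₁ = r u_r ≥ −Cν` on an axis tube,
in the standing class: classical on `[0,T)`, Leray–Hopf on `[0,T]` from `u 0`, bounded on
sub-slabs, axisymmetric slices, rapidly decaying datum) to three statements:
S1 `stub_cyclostrophicDefectFloor` (an `L¹`-in-time floor `−g(t)` for the cyclostrophic defect
`u_r² + u_θ² − r∂ᵣp = u₀² + u₁² − (x₀∂₀p + x₁∂₁p)` on an axis tube — OPEN, a one-sided statement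
about the pressure), S2 `stub_radialMomentumMinPrinciple` and S3 `stub_offAxisBound`.
S3 is `offAxisBound` (`…OffAxisBound.lean`). This file proves **S2 verbatim**
(`radialMomentumMinPrinciple`); the consequence BY NAME, `S1 → AprioriRadialInflowBound`, is
`…InflowFromDefectFloor.lean` (kept apart so that this module stays outside the Theses import
cone). So the open content of X₂ is exactly S1. Nothing here closes ⟨19060⟩ or ⟨1964⟩.

## Proof of S2

`radialMomentum_minPrinciple_engine`: the tree's weak parabolic maximum principle
`weak_max_principle_of_contDiffAt` (Lieberman 1996, Ch. II, Lemma 2.1) on `[0,t] × K`,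
`K = B̄(0,R) ∩ {r ≤ δ₁}`, for `w = −Φ − ∫₀ˢ g − δ₁M` with a continuous floor `g ≥ 0`: at an interior
critical point of `Φ(s,·)` with `ΔΦ ≥ 0`, either the point is on the axis (`∂ₜΦ = 0`) or, by
`timeDerivWithin_radialMomentum_of_critical` (convective term and, by axisymmetry, horizontal
divergence vanish), `∂ₜΦ = νΔΦ + defect ≥ −g(s)`; on the parabolic boundary `Φ ≥ −r|u| ≥ −δ₁M`.
`radialMomentumMinPrinciple`: the engine's data from the tree — `u` bounded near `T` off the
half-tube (`AxisymmetricL3Hyp.bounded_offTube`: CKN / Seregin–Šverák 2009 §3) and outside a large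
ball (`axisymmetricL3_boundedNearTop_infinity`), on sub-slabs before; the `L¹` floor regularised to
the continuous `g_K(t) = max(0, max_K(−defect(t,·))) ≤ g⁺(t)` (`IsCompact.continuous_sSup`).

References: Lieberman, *Second order parabolic differential equations* (1996), Ch. II L. 2.1;
Caffarelli–Kohn–Nirenberg, CPAM 35 (1982), Thm. B; Seregin–Šverák, arXiv:0804.1803, §3.
-/

noncomputable section

open Literature.Analysis.FluidPDE MeasureTheory Set Function Filter Topology Metric WithLp
open scoped InnerProductSpace RealInnerProductSpace Laplacian ContDiff

namespace Summit.NavierStokesRegularity.NavierStokesRegularity.Theorems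

-- the problem directory repeats the summit name (`NavierStokesRegularity/NavierStokesRegularity`)
set_option linter.dupNamespace false

/-! ### The minimum principle on a truncated axis tube (the engine) -/

/-- **The radial momentum against a velocity bound**: `x₀v₀ + x₁v₁ ≥ −δ M` when `cylRadius x ≤ δ`
and `‖v‖ ≤ M` (Cauchy–Schwarz in the horizontal plane). [folklore] -/
theorem radialMomentum_ge_neg_mul_of_norm_le {x v : EuclideanSpace ℝ (Fin 3)} {δ M : ℝ} (hx : cylRadius x ≤ δ)
    (hv : ‖v‖ ≤ M) : -(δ * M) ≤ x 0 * v 0 + x 1 * v 1 := by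
  have hr : 0 ≤ cylRadius x := cylRadius_nonneg x
  have hr2 : cylRadius x ^ 2 = x 0 ^ 2 + x 1 ^ 2 := cylRadius_sq x
  have hv2 : ‖v‖ ^ 2 = v 0 ^ 2 + v 1 ^ 2 + v 2 ^ 2 := by
    rw [EuclideanSpace.real_norm_sq_eq, Fin.sum_univ_three]
  have hsq : (x 0 * v 0 + x 1 * v 1) ^ 2 ≤ (cylRadius x * ‖v‖) ^ 2 := by
    rw [mul_pow, hr2, hv2]
    nlinarith [sq_nonneg (x 0 * v 1 - x 1 * v 0), sq_nonneg (v 2),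
      add_nonneg (sq_nonneg (x 0)) (sq_nonneg (x 1))]
  have h1 := (abs_le_of_sq_le_sq' hsq (mul_nonneg hr (norm_nonneg v))).1
  have h2 : cylRadius x * ‖v‖ ≤ δ * M := mul_le_mul hx hv (norm_nonneg _) (hr.trans hx)
  linarith

/-- **The radial-momentum minimum principle on a truncated axis tube (the engine).** Standing class
`AxisymmetricL3Hyp`; `K = B̄(0,R) ∩ {r ≤ δ₁}`, `U = B(0,R) ∩ {r < δ₁}`. If `|u| ≤ M` on `K ∖ U` for
`t ∈ [0,T)` and on `K` at `t = 0`, and the cyclostrophic defect `u₀² + u₁² − (x₀∂₀p + x₁∂₁p)` is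
`≥ −g(t)` on `U` with `g ≥ 0` continuous on `[0,T)`, `∫₀ᵗ g ≤ I`, then `x₀u₀ + x₁u₁ ≥ −(δ₁M + I)` on
`K × [0,T)`. Proof: `weak_max_principle_of_contDiffAt` on `[0,t] × K` for `w = −Φ − ∫₀ˢ g − δ₁M`; at
an interior critical point of `Φ(s,·)` with `ΔΦ ≥ 0`, `∂ₜΦ = 0` on the axis and
`∂ₜΦ = νΔΦ + defect ≥ −g(s)` off it (`timeDerivWithin_radialMomentum_of_critical`); on the parabolic
boundary `Φ ≥ −r|u| ≥ −δ₁M`. [new; method: Lieberman 1996 Ch. II Lemma 2.1] -/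
theorem radialMomentum_minPrinciple_engine {ν T : ℝ} {u : ℝ → EuclideanSpace ℝ (Fin 3) → EuclideanSpace ℝ (Fin 3)} {p : ℝ → EuclideanSpace ℝ (Fin 3) → ℝ}
    (H : AxisymmetricL3Hyp ν T u p) {δ₁ R M I : ℝ}
    {g : ℝ → ℝ} (hgc : ContinuousOn g (Ico 0 T)) (hg0 : ∀ t ∈ Ico 0 T, 0 ≤ g t)
    (hgI : ∀ t ∈ Ico 0 T, ∫ s in (0:ℝ)..t, g s ≤ I)
    (hfloor : ∀ t ∈ Ico 0 T, ∀ x ∈ ball (0 : EuclideanSpace ℝ (Fin 3)) R ∩ {x | cylRadius x < δ₁},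
      -g t ≤ (u t x 0) ^ 2 + (u t x 1) ^ 2
        - (x 0 * fderiv ℝ (p t) x (EuclideanSpace.single 0 1)
            + x 1 * fderiv ℝ (p t) x (EuclideanSpace.single 1 1)))
    (hlat : ∀ t ∈ Ico 0 T, ∀ x ∈ (closedBall (0 : EuclideanSpace ℝ (Fin 3)) R ∩ {x | cylRadius x ≤ δ₁}) \
      (ball (0 : EuclideanSpace ℝ (Fin 3)) R ∩ {x | cylRadius x < δ₁}), ‖u t x‖ ≤ M)
    (hbot : ∀ x ∈ closedBall (0 : EuclideanSpace ℝ (Fin 3)) R ∩ {x | cylRadius x ≤ δ₁}, ‖u 0 x‖ ≤ M) :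
    ∀ t ∈ Ico 0 T, ∀ x ∈ closedBall (0 : EuclideanSpace ℝ (Fin 3)) R ∩ {x | cylRadius x ≤ δ₁},
      -(δ₁ * M + I) ≤ x 0 * u t x 0 + x 1 * u t x 1 := by
  intro t ht x hx
  set K : Set (EuclideanSpace ℝ (Fin 3)) := closedBall (0 : EuclideanSpace ℝ (Fin 3)) R ∩ {x | cylRadius x ≤ δ₁} with hK_def
  set U : Set (EuclideanSpace ℝ (Fin 3)) := ball (0 : EuclideanSpace ℝ (Fin 3)) R ∩ {x | cylRadius x < δ₁} with hU_def
  set G : ℝ → ℝ := fun s => ∫ τ in (0:ℝ)..s, g τ with hG_def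
  set w : ℝ → EuclideanSpace ℝ (Fin 3) → ℝ := fun s y => -(y 0 * u s y 0 + y 1 * u s y 1) - G s - δ₁ * M with hw_def
  set wt : ℝ → EuclideanSpace ℝ (Fin 3) → ℝ := fun s y =>
    -(y 0 * timeDerivWithin (Ico 0 T) u s y 0 + y 1 * timeDerivWithin (Ico 0 T) u s y 1) - g s
    with hwt_def
  have hν := H.viscosity_pos
  have hsm := H.classical.smooth_velocity
  have htT : Icc 0 t ⊆ Ico 0 T := fun s hs => ⟨hs.1, hs.2.trans_lt ht.2⟩
  -- the radial momentum against a velocity bound on `K`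
  have hΦbd : ∀ (s : ℝ) (y : EuclideanSpace ℝ (Fin 3)), y ∈ K → ‖u s y‖ ≤ M →
      -(δ₁ * M) ≤ y 0 * u s y 0 + y 1 * u s y 1 := fun s y hy hMy =>
    radialMomentum_ge_neg_mul_of_norm_le hy.2 hMy
  -- the time integral of the floor
  have hG0 : G 0 = 0 := intervalIntegral.integral_same
  have hGnn : ∀ s ∈ Icc 0 t, 0 ≤ G s := fun s hs =>
    intervalIntegral.integral_nonneg hs.1 fun τ hτ => hg0 τ ⟨hτ.1, hτ.2.trans_lt (hs.2.trans_lt ht.2)⟩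
  -- the sets
  have hK : IsCompact K :=
    (isCompact_closedBall _ _).inter_right (isClosed_le continuous_cylRadius continuous_const)
  have hU : IsOpen U := isOpen_ball.inter (isOpen_lt continuous_cylRadius continuous_const)
  have hUK : U ⊆ K := fun y hy =>
    ⟨ball_subset_closedBall hy.1, (le_of_lt (hy.2 : cylRadius y < δ₁) : cylRadius y ≤ δ₁)⟩
  -- joint continuity of `w` on `[0,t] × K`
  have hc : ContinuousOn (uncurry w) (Icc 0 t ×ˢ K) := by
    have hu : ContinuousOn (uncurry u) (Icc 0 t ×ˢ K) :=
      hsm.continuousOn.mono (prod_mono htT (subset_univ _))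
    have h0 : ContinuousOn (fun q : ℝ × EuclideanSpace ℝ (Fin 3) => uncurry u q 0) (Icc 0 t ×ˢ K) :=
      (EuclideanSpace.proj (0 : Fin 3)).continuous.comp_continuousOn hu
    have h1 : ContinuousOn (fun q : ℝ × EuclideanSpace ℝ (Fin 3) => uncurry u q 1) (Icc 0 t ×ˢ K) :=
      (EuclideanSpace.proj (1 : Fin 3)).continuous.comp_continuousOn hu
    have hy0 : Continuous (fun q : ℝ × EuclideanSpace ℝ (Fin 3) => q.2 0) := (EuclideanSpace.proj (0 : Fin 3)).continuous.comp continuous_snd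
    have hy1 : Continuous (fun q : ℝ × EuclideanSpace ℝ (Fin 3) => q.2 1) := (EuclideanSpace.proj (1 : Fin 3)).continuous.comp continuous_snd
    have hGc : ContinuousOn G (Icc 0 t) := by
      have hint : IntegrableOn g (uIcc 0 t) := by
        rw [uIcc_of_le ht.1]
        exact (hgc.mono htT).integrableOn_compact isCompact_Icc
      have := intervalIntegral.continuousOn_primitive_interval (μ := volume) hint
      rwa [uIcc_of_le ht.1] at this
    have hGc' : ContinuousOn (fun q : ℝ × EuclideanSpace ℝ (Fin 3) => G q.1) (Icc 0 t ×ˢ K) :=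
      hGc.comp continuous_fst.continuousOn fun q hq => hq.1
    have e : uncurry w = fun q : ℝ × EuclideanSpace ℝ (Fin 3) =>
        -(q.2 0 * uncurry u q 0 + q.2 1 * uncurry u q 1) - G q.1 - δ₁ * M := by
      funext q
      rfl
    rw [e]
    exact ((((hy0.continuousOn.mul h0).add (hy1.continuousOn.mul h1)).neg.sub hGc').sub
      continuousOn_const)
  -- slice regularity
  have h2 : ∀ s ∈ Ioc 0 t, ∀ y ∈ U, ContDiffAt ℝ 2 (w s) y := by
    intro s hs y _
    have hs' : s ∈ Ico 0 T := ⟨hs.1.le, hs.2.trans_lt ht.2⟩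
    have hU2 : ContDiff ℝ 2 (u s) := (H.classical.contDiff_velocity hs').of_le (by norm_cast)
    exact (((contDiff_radialMomentum hU2).neg.sub contDiff_const).sub contDiff_const).contDiffAt
  -- the left time derivative
  have hderiv : ∀ s ∈ Ioc 0 t, ∀ y ∈ U,
      HasDerivWithinAt (fun τ => w τ y) (wt s y) (Icc 0 s) s := by
    intro s hs y _
    have hs' : s ∈ Ico 0 T := ⟨hs.1.le, hs.2.trans_lt ht.2⟩
    have hsT : s ∈ Ioo 0 T := ⟨hs.1, hs.2.trans_lt ht.2⟩
    have hΦ := (hasDerivWithinAt_radialMomentum hsm hs' y).mono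
      (show Icc 0 s ⊆ Ico 0 T from fun τ hτ => ⟨hτ.1, hτ.2.trans_lt hsT.2⟩)
    have hgs : ContinuousAt g s :=
      (hgc.mono Ioo_subset_Ico_self).continuousAt (isOpen_Ioo.mem_nhds hsT)
    have hmeas : StronglyMeasurableAtFilter g (𝓝 s) volume :=
      (hgc.mono Ioo_subset_Ico_self).stronglyMeasurableAtFilter isOpen_Ioo _ hsT
    have hii : IntervalIntegrable g volume 0 s := by
      refine (hgc.mono ?_).intervalIntegrable
      rw [uIcc_of_le hs.1.le]
      exact fun τ hτ => ⟨hτ.1, hτ.2.trans_lt hsT.2⟩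
    have hG : HasDerivAt G (g s) s := intervalIntegral.integral_hasDerivAt_right hii hmeas hgs
    exact (hΦ.neg.sub hG.hasDerivWithinAt).sub_const (δ₁ * M)
  -- the sub-solution property at interior critical points
  have hsub : ∀ s ∈ Ioc 0 t, ∀ y ∈ U, fderiv ℝ (w s) y = 0 → (Δ (w s)) y ≤ 0 → wt s y ≤ 0 := by
    intro s hs y hy hgrad hlap
    have hs' : s ∈ Ico 0 T := ⟨hs.1.le, hs.2.trans_lt ht.2⟩
    have hU2 : ContDiff ℝ 2 (u s) := (H.classical.contDiff_velocity hs').of_le (by norm_cast)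
    have hΦ2 : ContDiff ℝ 2 (fun z : EuclideanSpace ℝ (Fin 3) => z 0 * u s z 0 + z 1 * u s z 1) :=
      contDiff_radialMomentum hU2
    have hw_eq : w s = fun z => -(z 0 * u s z 0 + z 1 * u s z 1) - (G s + δ₁ * M) := by
      funext z
      simp only [hw_def]
      ring
    have hgradΦ : fderiv ℝ (fun z : EuclideanSpace ℝ (Fin 3) => z 0 * u s z 0 + z 1 * u s z 1) y = 0 := by
      have e : fderiv ℝ (w s) y = -fderiv ℝ (fun z : EuclideanSpace ℝ (Fin 3) => z 0 * u s z 0 + z 1 * u s z 1) y := by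
        rw [hw_eq, fderiv_sub_const, fderiv_fun_neg]
      rw [e] at hgrad
      exact neg_eq_zero.1 hgrad
    have hlapΦ : 0 ≤ (Δ (fun z : EuclideanSpace ℝ (Fin 3) => z 0 * u s z 0 + z 1 * u s z 1)) y := by
      have e : (Δ (w s)) y = -(Δ (fun z : EuclideanSpace ℝ (Fin 3) => z 0 * u s z 0 + z 1 * u s z 1)) y := by
        rw [hw_eq]
        exact laplacian_neg_sub_const hΦ2 _ y
      rw [e] at hlap
      linarith
    have hg0s := hg0 s hs'
    by_cases hax : cylRadius y = 0
    · obtain ⟨h0, h1⟩ := (cylRadius_eq_zero_iff y).1 hax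
      simp only [hwt_def, h0, h1, zero_mul, add_zero, neg_zero, zero_sub]
      linarith
    · have hUD : UniqueDiffWithinAt ℝ (Ico 0 T) s := uniqueDiffOn_Ico 0 T s hs'
      have hcrit := timeDerivWithin_radialMomentum_of_critical H.classical hs' hUD
        (H.axisymmetric s hs') hax hgradΦ
      have e := timeDerivWithin_radialMomentum hsm hs' hUD y
      have hfl := hfloor s hs' y hy
      have hνΔ : 0 ≤ ν * (Δ (fun z : EuclideanSpace ℝ (Fin 3) => z 0 * u s z 0 + z 1 * u s z 1)) y :=
        mul_nonneg hν.le hlapΦ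
      simp only [hwt_def]
      rw [← e, hcrit]
      simp only [Pi.zero_apply, PiLp.zero_apply, mul_zero, add_zero]
      linarith
  -- the parabolic boundary
  have hbot' : ∀ y ∈ K, w 0 y ≤ 0 := by
    intro y hy
    have h := hΦbd 0 y hy (hbot y hy)
    simp only [hw_def, hG0]
    linarith
  have hlat' : ∀ s ∈ Icc 0 t, ∀ y ∈ K \ U, w s y ≤ 0 := by
    intro s hs y hy
    have h := hΦbd s y hy.1 (hlat s (htT hs) y hy)
    have hG := hGnn s hs
    simp only [hw_def]
    linarith
  -- the weak maximum principle
  have key := weak_max_principle_of_contDiffAt hK hU hUK hc h2 hderiv hsub hbot' hlat' t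
    ⟨ht.1, le_rfl⟩ x hx
  have hGI : G t ≤ I := hgI t ht
  simp only [hw_def] at key
  linarith

/-! ### S2 of the birth skeleton, verbatim, and X₂ from S1 -/

/-- **S2 of the birth skeleton of `AprioriRadialInflowBound` (stmt-…-19060), verbatim: the
radial-momentum minimum principle.** In the standing class of the crux `AxisymSwirlRegular`, an
`L¹`-in-time floor `−g(t)` for the cyclostrophic defect `u₀² + u₁² − (x₀∂₀p + x₁∂₁p)` on an axis tube
`{cylRadius < δ}` implies `x₀u₀ + x₁u₁ ≥ −Cν` on `{cylRadius < δ/2} × [0,T)` (the off-tube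
boundedness hypothesis is not used — it is the theorem `offAxisBound`). Proof: truncate at `|x| ≤ R`
(far field bounded near `T`, `axisymmetricL3_boundedNearTop_infinity`; half-tube
`AxisymmetricL3Hyp.bounded_offTube`; sub-slab bound before), regularise the floor to the continuous
`g_K = max(0, max_K(−defect)) ≤ g⁺`, run `radialMomentum_minPrinciple_engine`;
`C = (δM/2 + ∫_{[0,T)} g⁺)/ν`. [new] -/
theorem radialMomentumMinPrinciple :
    ∀ (ν T : ℝ), 0 < ν → 0 < T → ∀ (u : ℝ → EuclideanSpace ℝ (Fin 3) → EuclideanSpace ℝ (Fin 3)) (p : ℝ → EuclideanSpace ℝ (Fin 3) → ℝ), Literature.Analysis.FluidPDE.IsClassicalNSSolutionOn (Set.Ico 0 T) ν 0 u p → Literature.Analysis.FluidPDE.IsLerayHopfOn T ν 0 (u 0) u → (∀ T' < T, ∃ M : ℝ, ∀ t ∈ Set.Icc 0 T', ∀ x, ‖u t x‖ ≤ M) → (∀ t ∈ Set.Ico 0 T, Literature.Analysis.FluidPDE.IsAxisymmetric (u t)) → Literature.Analysis.FluidPDE.HasRapidSpatialDecay (u 0) → (∃ (δ : ℝ) (g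 : ℝ → ℝ), 0 < δ ∧ MeasureTheory.IntegrableOn g (Set.Ico 0 T) ∧ ∀ t ∈ Set.Ico 0 T, ∀ x, Literature.Analysis.FluidPDE.cylRadius x < δ → -g t ≤ (u t x 0) ^ 2 + (u t x 1) ^ 2 - (x 0 * fderiv ℝ (p t) x (EuclideanSpace.single (0 : Fin 3) (1 : ℝ)) + x 1 * fderiv ℝ (p t) x (EuclideanSpace.single (1 : Fin 3) (1 : ℝ)))) → (∀ δ₀ : ℝ, 0 < δ₀ → ∃ M : ℝ, ∀ t ∈ Set.Ico 0 T, ∀ x, δ₀ ≤ Literature.Analysis.FluidPDE.cylRadius x → ‖u t x‖ ≤ M) → ∃ C δ : ℝ, 0 < δ ∧ ∀ t ∈ Set.Ico 0 T, ∀ x, Literature.Analysis.FluidPDE.cylRadius x < δ → -(C * ν) ≤ x 0 * u t x 0 + x 1 * u t x 1 := by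
  intro ν T hν hT u p hcl hLH hbd hax _ hS1 _
  obtain ⟨δ, g, hδ, hgi, hfl⟩ := hS1
  have H : AxisymmetricL3Hyp ν T u p := ⟨hν, hT, hcl, hLH, hbd, hax⟩
  have hδ2 : 0 < δ / 2 := half_pos hδ
  /- (a) velocity bounds: off the half-tube, in the far field, initially -/
  obtain ⟨R₀, r₁, K₁, hr₁, hfar⟩ := axisymmetricL3_boundedNearTop_infinity H
  obtain ⟨r₀, hr₀, M₀, hM₀⟩ := H.bounded_offTube hδ2
  have hρ : 0 < min r₀ r₁ := lt_min hr₀ hr₁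
  have hρ2 : 0 < min r₀ r₁ ^ 2 := pow_pos hρ 2
  set T' : ℝ := max (T - min r₀ r₁ ^ 2 / 2) 0 with hT'_def
  have hT'T : T' < T := max_lt (by linarith) hT
  obtain ⟨B, hB⟩ := hbd T' hT'T
  set R : ℝ := max R₀ 0 with hR_def
  set M : ℝ := max (max M₀ K₁) B with hM_def
  have h0T' : (0 : ℝ) ∈ Icc 0 T' := ⟨le_rfl, le_max_right _ _⟩
  have hslab : ∀ t ∈ Ico 0 T, t ≤ T - min r₀ r₁ ^ 2 → ∀ x, ‖u t x‖ ≤ M := by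
    intro t ht hle x
    have htI : t ∈ Icc 0 T' := ⟨ht.1, le_trans (by linarith) (le_max_left _ _)⟩
    exact (hB t htI x).trans (le_max_right _ _)
  have hr₀ρ : min r₀ r₁ ^ 2 ≤ r₀ ^ 2 := pow_le_pow_left₀ hρ.le (min_le_left _ _) 2
  have hr₁ρ : min r₀ r₁ ^ 2 ≤ r₁ ^ 2 := pow_le_pow_left₀ hρ.le (min_le_right _ _) 2
  have htube : ∀ t ∈ Ico 0 T, ∀ x, δ / 2 ≤ cylRadius x → ‖u t x‖ ≤ M := by
    intro t ht x hx
    by_cases hlt : T - r₀ ^ 2 < t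
    · exact (hM₀ t ⟨hlt, ht.2⟩ x hx).trans ((le_max_left _ _).trans (le_max_left _ _))
    · push Not at hlt
      exact hslab t ht (hlt.trans (by linarith)) x
  have hfarM : ∀ t ∈ Ico 0 T, ∀ x, R ≤ ‖x‖ → ‖u t x‖ ≤ M := by
    intro t ht x hx
    have hx' : R₀ ≤ ‖x‖ := (le_max_left _ _).trans hx
    by_cases hlt : T - r₁ ^ 2 < t
    · exact (hfar t ⟨hlt, ht.2⟩ x hx').trans ((le_max_right _ _).trans (le_max_left _ _))
    · push Not at hlt
      exact hslab t ht (hlt.trans (by linarith)) x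
  have hinit : ∀ x, ‖u 0 x‖ ≤ M := fun x => (hB 0 h0T' x).trans (le_max_right _ _)
  /- (b) the compact truncated tube and the regularised floor -/
  set K : Set (EuclideanSpace ℝ (Fin 3)) := closedBall (0 : EuclideanSpace ℝ (Fin 3)) R ∩ {x | cylRadius x ≤ δ / 2} with hK_def
  have hK : IsCompact K :=
    (isCompact_closedBall _ _).inter_right (isClosed_le continuous_cylRadius continuous_const)
  have h0K : (0 : EuclideanSpace ℝ (Fin 3)) ∈ K := by
    refine ⟨mem_closedBall_self (le_max_right _ _), ?_⟩
    show cylRadius 0 ≤ δ / 2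
    have : cylRadius (0 : EuclideanSpace ℝ (Fin 3)) = 0 := (cylRadius_eq_zero_iff 0).2 ⟨rfl, rfl⟩
    rw [this]
    exact hδ2.le
  have hKδ : ∀ x ∈ K, cylRadius x < δ := fun x hx => lt_of_le_of_lt hx.2 (half_lt_self hδ)
  set F : ℝ → EuclideanSpace ℝ (Fin 3) → ℝ := fun t x => (u t x 0) ^ 2 + (u t x 1) ^ 2
    - (x 0 * fderiv ℝ (p t) x (EuclideanSpace.single 0 1)
        + x 1 * fderiv ℝ (p t) x (EuclideanSpace.single 1 1)) with hF_def
  set gK : ℝ → ℝ := fun t => max (sSup ((fun x => -F t x) '' K)) 0 with hgK_def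
  -- joint continuity of the defect
  have hFc : ContinuousOn (uncurry F) (Ico 0 T ×ˢ univ) := by
    have hu := hcl.smooth_velocity.continuousOn
    have hDp := hcl.smooth_pressure.continuousOn_fderiv_slice (uniqueDiffOn_Ico 0 T)
    have hDp0 : ContinuousOn
        (fun z : ℝ × EuclideanSpace ℝ (Fin 3) => fderiv ℝ (p z.1) z.2 (EuclideanSpace.single 0 1)) (Ico 0 T ×ˢ univ) :=
      hDp.clm_apply continuousOn_const
    have hDp1 : ContinuousOn
        (fun z : ℝ × EuclideanSpace ℝ (Fin 3) => fderiv ℝ (p z.1) z.2 (EuclideanSpace.single 1 1)) (Ico 0 T ×ˢ univ) :=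
      hDp.clm_apply continuousOn_const
    have hu0 : ContinuousOn (fun z : ℝ × EuclideanSpace ℝ (Fin 3) => uncurry u z 0) (Ico 0 T ×ˢ univ) :=
      (EuclideanSpace.proj (0 : Fin 3)).continuous.comp_continuousOn hu
    have hu1 : ContinuousOn (fun z : ℝ × EuclideanSpace ℝ (Fin 3) => uncurry u z 1) (Ico 0 T ×ˢ univ) :=
      (EuclideanSpace.proj (1 : Fin 3)).continuous.comp_continuousOn hu
    have hx0 : Continuous (fun z : ℝ × EuclideanSpace ℝ (Fin 3) => z.2 0) := (EuclideanSpace.proj (0 : Fin 3)).continuous.comp continuous_snd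
    have hx1 : Continuous (fun z : ℝ × EuclideanSpace ℝ (Fin 3) => z.2 1) := (EuclideanSpace.proj (1 : Fin 3)).continuous.comp continuous_snd
    have e : uncurry F = fun z : ℝ × EuclideanSpace ℝ (Fin 3) => (uncurry u z 0) ^ 2 + (uncurry u z 1) ^ 2
        - (z.2 0 * fderiv ℝ (p z.1) z.2 (EuclideanSpace.single 0 1)
            + z.2 1 * fderiv ℝ (p z.1) z.2 (EuclideanSpace.single 1 1)) := by
      funext z
      rfl
    rw [e]
    exact ((hu0.pow 2).add (hu1.pow 2)).sub ((hx0.continuousOn.mul hDp0).add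
      (hx1.continuousOn.mul hDp1))
  -- continuity of the regularised floor
  have hgKc : ContinuousOn gK (Ico 0 T) := by
    have hneg : Continuous (↿(fun (s : Ico 0 T) (x : EuclideanSpace ℝ (Fin 3)) => -F s x)) := by
      have e : (↿fun (s : Ico 0 T) (x : EuclideanSpace ℝ (Fin 3)) => -F s x) =
          fun q : Ico 0 T × EuclideanSpace ℝ (Fin 3) => -(uncurry F (Prod.map Subtype.val id q)) := by
        funext q
        rfl
      rw [e]
      exact (hFc.comp_continuous (continuous_subtype_val.prodMap continuous_id)
        fun q => ⟨q.1.2, mem_univ _⟩).neg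
    have hsup : Continuous fun s : Ico 0 T => sSup ((fun x => -F s x) '' K) :=
      hK.continuous_sSup hneg
    rw [continuousOn_iff_continuous_restrict]
    exact hsup.max continuous_const
  -- floor property on `K`, domination by `g⁺`, sign
  have hbdd : ∀ t ∈ Ico 0 T, BddAbove ((fun x => -F t x) '' K) := by
    intro t ht
    refine ⟨g t, ?_⟩
    rintro _ ⟨x, hx, rfl⟩
    have := hfl t ht x (hKδ x hx)
    show -F t x ≤ g t
    simp only [hF_def]
    linarith
  have hgK_floor : ∀ t ∈ Ico 0 T, ∀ x ∈ K, -gK t ≤ F t x := by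
    intro t ht x hx
    have h1 : -F t x ≤ sSup ((fun x => -F t x) '' K) := le_csSup (hbdd t ht) ⟨x, hx, rfl⟩
    have h2 : sSup ((fun x => -F t x) '' K) ≤ gK t := le_max_left _ _
    linarith
  have hgK_le : ∀ t ∈ Ico 0 T, gK t ≤ max (g t) 0 := by
    intro t ht
    have h1 : sSup ((fun x => -F t x) '' K) ≤ g t := by
      refine csSup_le ⟨_, ⟨0, h0K, rfl⟩⟩ ?_
      rintro _ ⟨x, hx, rfl⟩
      have := hfl t ht x (hKδ x hx)
      show -F t x ≤ g t
      simp only [hF_def]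
      linarith
    exact max_le_max h1 le_rfl
  have hgK0 : ∀ t ∈ Ico 0 T, 0 ≤ gK t := fun t _ => le_max_right _ _
  -- the time integral of the regularised floor
  set I : ℝ := ∫ s in Ico 0 T, max (g s) 0 with hI_def
  have hgpos : IntegrableOn (fun s => max (g s) 0) (Ico 0 T) := hgi.pos_part
  have hI0 : 0 ≤ I := setIntegral_nonneg measurableSet_Ico fun s _ => le_max_right _ _
  have hgK_int : IntegrableOn gK (Ico 0 T) := by
    refine Integrable.mono' hgpos (hgKc.aestronglyMeasurable measurableSet_Ico) ?_
    filter_upwards [ae_restrict_mem measurableSet_Ico] with s hs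
    rw [Real.norm_eq_abs, abs_of_nonneg (hgK0 s hs)]
    exact hgK_le s hs
  have hgKI : ∀ t ∈ Ico 0 T, ∫ s in (0:ℝ)..t, gK s ≤ I := by
    intro t ht
    rw [intervalIntegral.integral_of_le ht.1]
    calc ∫ s in Ioc 0 t, gK s ≤ ∫ s in Ico 0 T, gK s := by
          refine setIntegral_mono_set hgK_int ?_ ?_
          · filter_upwards [ae_restrict_mem measurableSet_Ico] with s hs using hgK0 s hs
          · exact (show Ioc 0 t ⊆ Ico 0 T from fun s hs => ⟨hs.1.le, hs.2.trans_lt ht.2⟩).eventuallyLE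
      _ ≤ I := setIntegral_mono_on hgK_int hgpos measurableSet_Ico fun s hs => hgK_le s hs
  /- (c) the engine on `K × [0,T)` -/
  have key := radialMomentum_minPrinciple_engine H hgKc hgK0 hgKI
    (fun t ht x hx => hgK_floor t ht x
      ⟨ball_subset_closedBall hx.1, (le_of_lt (hx.2 : cylRadius x < δ / 2) : cylRadius x ≤ δ / 2)⟩)
    (fun t ht x hx => by
      by_cases hxR : R ≤ ‖x‖
      · exact hfarM t ht x hxR
      · have hxb : x ∈ ball (0 : EuclideanSpace ℝ (Fin 3)) R := mem_ball_zero_iff.2 (lt_of_not_ge hxR)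
        have hxr : δ / 2 ≤ cylRadius x := by
          by_contra hlt
          exact hx.2 ⟨hxb, lt_of_not_ge hlt⟩
        exact htube t ht x hxr)
    (fun x _ => hinit x)
  /- (d) conclusion on the half tube -/
  refine ⟨(δ / 2 * M + I) / ν, δ / 2, hδ2, fun t ht x hx => ?_⟩
  have hCν : (δ / 2 * M + I) / ν * ν = δ / 2 * M + I := div_mul_cancel₀ _ hν.ne'
  rw [hCν]
  by_cases hxR : ‖x‖ ≤ R
  · exact key t ht x ⟨mem_closedBall_zero_iff.2 hxR, (le_of_lt hx : cylRadius x ≤ δ / 2)⟩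
  · have h1 := radialMomentum_ge_neg_mul_of_norm_le (le_of_lt hx) (hfarM t ht x (le_of_not_ge hxR))
    linarith

end Summit.NavierStokesRegularity.NavierStokesRegularity.Theorems

end
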